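import Summits.CriticalPhenomena.CardyFormulaZ2.Theorems.CardyWhiteToColouredSimilarityUpgradeHeartsCoincide
import Summits.CriticalPhenomena.CardyFormulaZ2.Theorems.CardyWhiteToColouredSimilarityUpgradeStubRectangleFamily

/-!
# Stub `stub_heartSansSim` (line `registered`, crux `SimilarityUpgrade`, stmt-CriticalPhenomena-4597)

Crux `Summit.CriticalPhenomena.CardyFormulaZ2.Theses.CardyWhiteToColoured.SimilarityUpgrade`,
route `CardyWhiteToColoured`, sub-problem `CardyFormulaZ2`, line `registered`, c5 goal stub
`stub_heartSansSim`.

The registered heart **H3** (`stub_rectilinearHeart`) of this line reads: *if* the bond-`ℤ²`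
crossing probabilities of every conformal rectangle converge to a full limit `Φ` which is
similarity invariant, then a rectilinear conformal rectangle `R` and the corner-marked box
`R' = ((0,w) × (0,1); i, 0, w, w + i)` carrying uniformizing data of equal cross-ratio have
`Φ R = Φ R'`.  Lead c3 showed that the similarity-invariance hypothesis (ii) of H3 is idle, but only
modulo the vendored DKKMO rotation theorem.  Here hypothesis (ii) is simply **deleted**; call the
resulting statement **H3''**.  Then, over tree theorems only and WITHOUT DKKMO:

* `heartSansSim_of_rectilinearInvariance` — **S1 ⇒ H3''** unconditionally, where S1 is the
  registered (limit-free) heart `stub_rectilinearInvariance` of the sibling crux `ConfInvTransport`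
  (stmt-0794): the corner box is rectilinear (`isRectilinear_of_carrier_eq`), so S1 gives
  `P R δ - P R' δ → 0`, while `P R → Φ R`, `P R' → Φ R'`; uniqueness of limits along `𝓝[>] 0`.
* `rectilinearInvariance_of_heartSansSim_of_limitExists` — **`LimitExists` → H3'' → S1**: choose the
  limits `Φ`; for rectilinear `Q, Q'` with data of equal cross-ratio `η ∈ (0,1)` take c1's corner box
  `B` of modulus `η` (`RectangleFamily.surj`) with a uniformizing datum
  (`MarkedDomain.exists_isUniformizing_holds`); H3'' twice gives `Φ Q = Φ B = Φ Q'`, hence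
  `P Q - P Q' → 0`.
* `heart_of_heartSansSim` — **H3'' ⇒ H3** (drop the idle hypothesis).
* `thesis_tfae4_of_limitExists` — under `LimitExists`, **X_U ⇔ `ConfInvTransport` ⇔ S1 ⇔ H3''**
  (`List.TFAE`, no DKKMO), extending `thesis_tfae_of_limitExists` of the lead's HeartsCoincide file.
* `stub_heartSansSim` — the registered form `LimitExists → (H3'' ↔ S1)`.

All statements are spelled out verbatim (they are registered stub statements of the two
skeletons); no definition or notation is introduced.

References: O. Schramm, Proc. ICM 2006, §2.6 Problem 2.11; B. Bollobás, O. Riordan,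
*Percolation* (2006), Ch. 7 §7.1 p. 185 and Conjecture 1; S. Smirnov, C. R. Acad. Sci. 333 (2001),
Thm 1; L. V. Ahlfors, *Complex Analysis* (1979), Ch. 6 §2.3.
-/

noncomputable section

namespace Summit.CriticalPhenomena.CardyFormulaZ2.Cruxes.SimilarityUpgrade.Stubs

open Filter Topology Set MeasureTheory
open Literature.Probability.RandomPlanarGeometry
open Literature.Probability.Percolation
open Summit.CriticalPhenomena.CardyFormulaZ2.Theses.CardyUniqueLimit (CardyUniqueLimitThesis
  LimitExists ConfInvTransport)
open Summit.CriticalPhenomena.CardyFormulaZ2.Theorems.SimilarityUpgradeReduction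
  (confInvTransport_of_thesis rectilinearInvariance_of_confInvTransport_of_limitExists
    thesis_of_confInvTransport_of_limitExists confInvTransport_of_rectilinearInvariance)
open Summit.CriticalPhenomena.CardyFormulaZ2.Theorems.RectilinearCardy.Negative
  (isRectilinear_of_carrier_eq)

/-! ### S1 ⇒ H3'' (unconditional) -/

/-- **S1 ⇒ H3''**: the limit-free rectilinear invariance (heart of crux stmt-0794's line) implies
the heart of crux stmt-4597's line with its similarity-invariance hypothesis deleted.  The corner
box `R' = (0,w) × (0,1)` is rectilinear (its frontier is the union of its four axis-parallel
sides, `isRectilinear_of_carrier_eq`), so S1 gives `P R δ - P R' δ → 0`; with `P R → Φ R` and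
`P R' → Φ R'` the difference also tends to `Φ R - Φ R'`, whence `Φ R = Φ R'` by uniqueness of
limits along the non-trivial filter `𝓝[>] 0`. -/
theorem heartSansSim_of_rectilinearInvariance (h₁ : (∀ (Q Q' : ConformalRectangle),
      (∃ S : Finset (ℂ × ℂ), (∀ p ∈ S, p.1.re = p.2.re ∨ p.1.im = p.2.im) ∧
        frontier Q.carrier ⊆ ⋃ p ∈ S, segment ℝ p.1 p.2) →
      (∃ S : Finset (ℂ × ℂ), (∀ p ∈ S, p.1.re = p.2.re ∨ p.1.im = p.2.im) ∧
        frontier Q'.carrier ⊆ ⋃ p ∈ S, segment ℝ p.1 p.2) →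
      ∀ (ψ : ConformalEquiv UpperHalfPlane.upperHalfPlaneSet Q.carrier) (y : Fin 4 → ℝ)
        (ψ' : ConformalEquiv UpperHalfPlane.upperHalfPlaneSet Q'.carrier) (y' : Fin 4 → ℝ),
        Q.IsUniformizing ψ y → Q'.IsUniformizing ψ' y' → crossRatio y = crossRatio y' →
        Tendsto (fun δ : ℝ => bondDomainCrossingProb Q δ - bondDomainCrossingProb Q' δ)
          (𝓝[>] (0 : ℝ)) (𝓝 0))) :
    (∀ Φ : ConformalRectangle → ℝ,
      (∀ R : ConformalRectangle, Tendsto (bondDomainCrossingProb R) (𝓝[>] (0 : ℝ)) (𝓝 (Φ R))) →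
      ∀ (R R' : ConformalRectangle),
        (∃ S : Finset (ℂ × ℂ), (∀ p ∈ S, p.1.re = p.2.re ∨ p.1.im = p.2.im) ∧
          frontier R.carrier ⊆ ⋃ p ∈ S, segment ℝ p.1 p.2) →
        (∃ w : ℝ, 0 < w ∧ R'.carrier = (Ioo (0 : ℝ) w ×ℂ Ioo (0 : ℝ) 1) ∧
          R'.arc 0 = {z : ℂ | z.re = 0 ∧ z.im ∈ Icc (0 : ℝ) 1} ∧
          R'.arc 2 = {z : ℂ | z.re = w ∧ z.im ∈ Icc (0 : ℝ) 1} ∧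
          R'.pt 0 = Complex.I ∧ R'.pt 1 = 0 ∧ R'.pt 2 = (w : ℂ) ∧ R'.pt 3 = (w : ℂ) + Complex.I) →
        ∀ (φ : ConformalEquiv UpperHalfPlane.upperHalfPlaneSet R.carrier) (x : Fin 4 → ℝ)
          (φ' : ConformalEquiv UpperHalfPlane.upperHalfPlaneSet R'.carrier) (x' : Fin 4 → ℝ),
          R.IsUniformizing φ x → R'.IsUniformizing φ' x' → crossRatio x = crossRatio x' →
          Φ R = Φ R') := by
  intro Φ hlim R R' hR hR' φ x φ' x' hx hx' hη
  obtain ⟨w, hw, hcar, -⟩ := hR'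
  have h0 := h₁ R R' hR (isRectilinear_of_carrier_eq hw one_pos hcar) φ x φ' x' hx hx' hη
  exact sub_eq_zero.1 (tendsto_nhds_unique ((hlim R).sub (hlim R')) h0)

/-! ### `LimitExists` → H3'' → S1 -/

/-- **Under `LimitExists`, H3'' ⇒ S1**: choose the limits `Φ R` of all crossing probabilities; for
rectilinear `Q, Q'` with uniformizing data of equal cross-ratio `η = crossRatio y ∈ (0,1)`
(`ConformalRectangle.crossRatio_mem_Ioo_of_isUniformizing`) take the corner-marked box
`B = ((0,w) × (0,1); i, 0, w, w + i)` of modulus `η` (c1's family `RectangleFamily.surj`,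
`lr_family`, `lr_pt`) and a uniformizing datum of `B` (`MarkedDomain.exists_isUniformizing_holds`);
H3'' applied to `(Q, B)` and `(Q', B)` gives `Φ Q = Φ B = Φ Q'`, so
`P Q δ - P Q' δ → Φ Q - Φ Q' = 0`.  No rotation invariance (DKKMO) is used.
[cite: BollobasRiordan2006, Ch. 7 §7.1 p. 185] -/
theorem rectilinearInvariance_of_heartSansSim_of_limitExists (hL : LimitExists)
    (hH : (∀ Φ : ConformalRectangle → ℝ,
      (∀ R : ConformalRectangle, Tendsto (bondDomainCrossingProb R) (𝓝[>] (0 : ℝ)) (𝓝 (Φ R))) →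
      ∀ (R R' : ConformalRectangle),
        (∃ S : Finset (ℂ × ℂ), (∀ p ∈ S, p.1.re = p.2.re ∨ p.1.im = p.2.im) ∧
          frontier R.carrier ⊆ ⋃ p ∈ S, segment ℝ p.1 p.2) →
        (∃ w : ℝ, 0 < w ∧ R'.carrier = (Ioo (0 : ℝ) w ×ℂ Ioo (0 : ℝ) 1) ∧
          R'.arc 0 = {z : ℂ | z.re = 0 ∧ z.im ∈ Icc (0 : ℝ) 1} ∧
          R'.arc 2 = {z : ℂ | z.re = w ∧ z.im ∈ Icc (0 : ℝ) 1} ∧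
          R'.pt 0 = Complex.I ∧ R'.pt 1 = 0 ∧ R'.pt 2 = (w : ℂ) ∧ R'.pt 3 = (w : ℂ) + Complex.I) →
        ∀ (φ : ConformalEquiv UpperHalfPlane.upperHalfPlaneSet R.carrier) (x : Fin 4 → ℝ)
          (φ' : ConformalEquiv UpperHalfPlane.upperHalfPlaneSet R'.carrier) (x' : Fin 4 → ℝ),
          R.IsUniformizing φ x → R'.IsUniformizing φ' x' → crossRatio x = crossRatio x' →
          Φ R = Φ R')) :
    (∀ (Q Q' : ConformalRectangle),
      (∃ S : Finset (ℂ × ℂ), (∀ p ∈ S, p.1.re = p.2.re ∨ p.1.im = p.2.im) ∧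
        frontier Q.carrier ⊆ ⋃ p ∈ S, segment ℝ p.1 p.2) →
      (∃ S : Finset (ℂ × ℂ), (∀ p ∈ S, p.1.re = p.2.re ∨ p.1.im = p.2.im) ∧
        frontier Q'.carrier ⊆ ⋃ p ∈ S, segment ℝ p.1 p.2) →
      ∀ (ψ : ConformalEquiv UpperHalfPlane.upperHalfPlaneSet Q.carrier) (y : Fin 4 → ℝ)
        (ψ' : ConformalEquiv UpperHalfPlane.upperHalfPlaneSet Q'.carrier) (y' : Fin 4 → ℝ),
        Q.IsUniformizing ψ y → Q'.IsUniformizing ψ' y' → crossRatio y = crossRatio y' →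
        Tendsto (fun δ : ℝ => bondDomainCrossingProb Q δ - bondDomainCrossingProb Q' δ)
          (𝓝[>] (0 : ℝ)) (𝓝 0)) := by
  intro Q Q' hQ hQ' ψ y ψ' y' hy hy' hη
  choose Φ hΦ using hL
  -- c1's corner-marked box family `sh (Qb w)`: carrier `(0,w) × (0,1)`, marks `i, 0, w, w + i`
  choose sh hsh using RectangleFamily.exists_shift3
  obtain ⟨Qb, hQb⟩ : ∃ Qb : ℝ → ConformalRectangle,
      ∀ (w : ℝ) (hw : 0 < w), Qb w = rectQuad 0 w 0 1 hw one_pos :=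
    ⟨fun w => if hw : 0 < w then rectQuad 0 w 0 1 hw one_pos else rectQuad 0 1 0 1 one_pos one_pos,
      fun w hw => dif_pos hw⟩
  -- a corner box of modulus `crossRatio y ∈ (0,1)` and a uniformizing datum of it
  obtain ⟨w, hw, hmod⟩ := RectangleFamily.surj sh hsh Qb hQb (crossRatio y)
    (ConformalRectangle.crossRatio_mem_Ioo_of_isUniformizing hy)
  obtain ⟨ψb, yb, hψb⟩ := MarkedDomain.exists_isUniformizing_holds (sh (Qb w))
  have hmodb : crossRatio yb = crossRatio y := hmod ψb yb hψb
  obtain ⟨hcar, ha0, ha2⟩ := RectangleFamily.lr_family sh hsh Qb hQb w hw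
  obtain ⟨p0, p1, p2, p3⟩ := RectangleFamily.lr_pt sh hsh Qb hQb w hw
  -- H3'' twice: `Φ Q = Φ B` and `Φ Q' = Φ B`
  have e1 : Φ Q = Φ (sh (Qb w)) :=
    hH Φ hΦ Q (sh (Qb w)) hQ ⟨w, hw, hcar, ha0, ha2, p0, p1, p2, p3⟩ ψ y ψb yb hy hψb hmodb.symm
  have e2 : Φ Q' = Φ (sh (Qb w)) :=
    hH Φ hΦ Q' (sh (Qb w)) hQ' ⟨w, hw, hcar, ha0, ha2, p0, p1, p2, p3⟩ ψ' y' ψb yb hy' hψb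
      (by rw [hmodb, hη])
  have key := (hΦ Q).sub (hΦ Q')
  rw [e1, e2, sub_self] at key
  exact key

/-! ### H3'' ⇒ H3, and the DKKMO-free equivalences under `LimitExists` -/

/-- **H3'' ⇒ H3**: the registered heart `stub_rectilinearHeart` of this line follows from its
variant without the similarity-invariance hypothesis (the extra hypothesis is ignored). -/
theorem heart_of_heartSansSim (hH : (∀ Φ : ConformalRectangle → ℝ,
      (∀ R : ConformalRectangle, Tendsto (bondDomainCrossingProb R) (𝓝[>] (0 : ℝ)) (𝓝 (Φ R))) →
      ∀ (R R' : ConformalRectangle),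
        (∃ S : Finset (ℂ × ℂ), (∀ p ∈ S, p.1.re = p.2.re ∨ p.1.im = p.2.im) ∧
          frontier R.carrier ⊆ ⋃ p ∈ S, segment ℝ p.1 p.2) →
        (∃ w : ℝ, 0 < w ∧ R'.carrier = (Ioo (0 : ℝ) w ×ℂ Ioo (0 : ℝ) 1) ∧
          R'.arc 0 = {z : ℂ | z.re = 0 ∧ z.im ∈ Icc (0 : ℝ) 1} ∧
          R'.arc 2 = {z : ℂ | z.re = w ∧ z.im ∈ Icc (0 : ℝ) 1} ∧
          R'.pt 0 = Complex.I ∧ R'.pt 1 = 0 ∧ R'.pt 2 = (w : ℂ) ∧ R'.pt 3 = (w : ℂ) + Complex.I) →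
        ∀ (φ : ConformalEquiv UpperHalfPlane.upperHalfPlaneSet R.carrier) (x : Fin 4 → ℝ)
          (φ' : ConformalEquiv UpperHalfPlane.upperHalfPlaneSet R'.carrier) (x' : Fin 4 → ℝ),
          R.IsUniformizing φ x → R'.IsUniformizing φ' x' → crossRatio x = crossRatio x' →
          Φ R = Φ R')) :
    (∀ Φ : ConformalRectangle → ℝ,
      (∀ R : ConformalRectangle, Tendsto (bondDomainCrossingProb R) (𝓝[>] (0 : ℝ)) (𝓝 (Φ R))) →
      (∀ (R R' : ConformalRectangle) (a w : ℂ), a ≠ 0 →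
        R'.carrier = (fun z : ℂ => a * z + w) '' R.carrier →
        R'.arc 0 = (fun z : ℂ => a * z + w) '' R.arc 0 →
        R'.arc 2 = (fun z : ℂ => a * z + w) '' R.arc 2 → Φ R' = Φ R) →
      ∀ (R R' : ConformalRectangle),
        (∃ S : Finset (ℂ × ℂ), (∀ p ∈ S, p.1.re = p.2.re ∨ p.1.im = p.2.im) ∧
          frontier R.carrier ⊆ ⋃ p ∈ S, segment ℝ p.1 p.2) →
        (∃ w : ℝ, 0 < w ∧ R'.carrier = (Ioo (0 : ℝ) w ×ℂ Ioo (0 : ℝ) 1) ∧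
          R'.arc 0 = {z : ℂ | z.re = 0 ∧ z.im ∈ Icc (0 : ℝ) 1} ∧
          R'.arc 2 = {z : ℂ | z.re = w ∧ z.im ∈ Icc (0 : ℝ) 1} ∧
          R'.pt 0 = Complex.I ∧ R'.pt 1 = 0 ∧ R'.pt 2 = (w : ℂ) ∧ R'.pt 3 = (w : ℂ) + Complex.I) →
        ∀ (φ : ConformalEquiv UpperHalfPlane.upperHalfPlaneSet R.carrier) (x : Fin 4 → ℝ)
          (φ' : ConformalEquiv UpperHalfPlane.upperHalfPlaneSet R'.carrier) (x' : Fin 4 → ℝ),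
          R.IsUniformizing φ x → R'.IsUniformizing φ' x' → crossRatio x = crossRatio x' →
          Φ R = Φ R') :=
  fun Φ hlim _ => hH Φ hlim

/-- **Under `LimitExists`, X_U, `ConfInvTransport`, S1 and H3'' are equivalent — without DKKMO**:
the arrows X_U ⇒ `ConfInvTransport` ⇒ S1 ⇒ X_U of `thesis_tfae_of_limitExists` (lead c5) together
with S1 ⇒ H3'' (`heartSansSim_of_rectilinearInvariance`) and H3'' ⇒ S1
(`rectilinearInvariance_of_heartSansSim_of_limitExists`). -/
theorem thesis_tfae4_of_limitExists (hL : LimitExists) :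
    List.TFAE [CardyUniqueLimitThesis, ConfInvTransport,
      (∀ (Q Q' : ConformalRectangle),
      (∃ S : Finset (ℂ × ℂ), (∀ p ∈ S, p.1.re = p.2.re ∨ p.1.im = p.2.im) ∧
        frontier Q.carrier ⊆ ⋃ p ∈ S, segment ℝ p.1 p.2) →
      (∃ S : Finset (ℂ × ℂ), (∀ p ∈ S, p.1.re = p.2.re ∨ p.1.im = p.2.im) ∧
        frontier Q'.carrier ⊆ ⋃ p ∈ S, segment ℝ p.1 p.2) →
      ∀ (ψ : ConformalEquiv UpperHalfPlane.upperHalfPlaneSet Q.carrier) (y : Fin 4 → ℝ)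
        (ψ' : ConformalEquiv UpperHalfPlane.upperHalfPlaneSet Q'.carrier) (y' : Fin 4 → ℝ),
        Q.IsUniformizing ψ y → Q'.IsUniformizing ψ' y' → crossRatio y = crossRatio y' →
        Tendsto (fun δ : ℝ => bondDomainCrossingProb Q δ - bondDomainCrossingProb Q' δ)
          (𝓝[>] (0 : ℝ)) (𝓝 0)),
      (∀ Φ : ConformalRectangle → ℝ,
      (∀ R : ConformalRectangle, Tendsto (bondDomainCrossingProb R) (𝓝[>] (0 : ℝ)) (𝓝 (Φ R))) →
      ∀ (R R' : ConformalRectangle),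
        (∃ S : Finset (ℂ × ℂ), (∀ p ∈ S, p.1.re = p.2.re ∨ p.1.im = p.2.im) ∧
          frontier R.carrier ⊆ ⋃ p ∈ S, segment ℝ p.1 p.2) →
        (∃ w : ℝ, 0 < w ∧ R'.carrier = (Ioo (0 : ℝ) w ×ℂ Ioo (0 : ℝ) 1) ∧
          R'.arc 0 = {z : ℂ | z.re = 0 ∧ z.im ∈ Icc (0 : ℝ) 1} ∧
          R'.arc 2 = {z : ℂ | z.re = w ∧ z.im ∈ Icc (0 : ℝ) 1} ∧
          R'.pt 0 = Complex.I ∧ R'.pt 1 = 0 ∧ R'.pt 2 = (w : ℂ) ∧ R'.pt 3 = (w : ℂ) + Complex.I) →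
        ∀ (φ : ConformalEquiv UpperHalfPlane.upperHalfPlaneSet R.carrier) (x : Fin 4 → ℝ)
          (φ' : ConformalEquiv UpperHalfPlane.upperHalfPlaneSet R'.carrier) (x' : Fin 4 → ℝ),
          R.IsUniformizing φ x → R'.IsUniformizing φ' x' → crossRatio x = crossRatio x' →
          Φ R = Φ R')] := by
  tfae_have 1 → 2 := confInvTransport_of_thesis
  tfae_have 2 → 3 := rectilinearInvariance_of_confInvTransport_of_limitExists hL
  tfae_have 3 → 4 := heartSansSim_of_rectilinearInvariance
  tfae_have 4 → 3 := rectilinearInvariance_of_heartSansSim_of_limitExists hL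
  tfae_have 3 → 1 := fun h₁ =>
    thesis_of_confInvTransport_of_limitExists hL (confInvTransport_of_rectilinearInvariance h₁)
  tfae_finish

/-! ### Registered form (c5 goal of crux stmt-CriticalPhenomena-4597) -/

/-- **Registered c5 goal `stub_heartSansSim` (line `registered`, lead c5).** Under `LimitExists`
(every conformal rectangle has a bond-`ℤ²` crossing limit), the heart H3 of this line WITH ITS
SIMILARITY-INVARIANCE HYPOTHESIS DELETED (full limits ⇒ a rectilinear `R` and the corner-marked box
`R'` of equal modulus have the same limit) is EQUIVALENT to the registered limit-free heart S1
(`stub_rectilinearInvariance`) of the sibling crux `ConfInvTransport` (stmt-0794): H3'' ⇒ S1 by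
`rectilinearInvariance_of_heartSansSim_of_limitExists` (corner box of the common modulus as a
pivot), S1 ⇒ H3'' by `heartSansSim_of_rectilinearInvariance` (unconditional).  No rotation
invariance (DKKMO) enters. [cite: BollobasRiordan2006, Ch. 7 §7.1 p. 185 and Conjecture 1] -/
theorem stub_heartSansSim : Summit.CriticalPhenomena.CardyFormulaZ2.Theses.CardyUniqueLimit.LimitExists → ((∀ Φ : ConformalRectangle → ℝ, (∀ R : ConformalRectangle, Tendsto (bondDomainCrossingProb R) (𝓝[>] (0 : ℝ)) (𝓝 (Φ R))) → ∀ (R R' : ConformalRectangle), (∃ S : Finset (ℂ × ℂ), (∀ p ∈ S, p.1.re = p.2.re ∨ p.1.im = p.2.im) ∧ frontier R.carrier ⊆ ⋃ p ∈ S, segment ℝ p.1 p.2) → (∃ w : ℝ, 0 < w ∧ R'.carrier = (Ioo (0 : ℝ) w ×ℂ Ioo (0 : ℝ) 1) ∧ R'.arc 0 = {z : ℂ | z.re = 0 ∧ z.im ∈ Icc (0 : ℝ) 1} ∧ R'.arc 2 = {z : ℂ | z.re = w ∧ z.im ∈ Icc (0 : ℝ) 1} ∧ R'.pt 0 = Complex.I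 ∧ R'.pt 1 = 0 ∧ R'.pt 2 = (w : ℂ) ∧ R'.pt 3 = (w : ℂ) + Complex.I) → ∀ (φ : ConformalEquiv UpperHalfPlane.upperHalfPlaneSet R.carrier) (x : Fin 4 → ℝ) (φ' : ConformalEquiv UpperHalfPlane.upperHalfPlaneSet R'.carrier) (x' : Fin 4 → ℝ), R.IsUniformizing φ x → R'.IsUniformizing φ' x' → crossRatio x = crossRatio x' → Φ R = Φ R') ↔ (∀ (Q Q' : ConformalRectangle), (∃ S : Finset (ℂ × ℂ), (∀ p ∈ S, p.1.re = p.2.re ∨ p.1.im = p.2.im) ∧ frontier Q.carrier ⊆ ⋃ p ∈ S, segment ℝ p.1 p.2) → (∃ S : Finset (ℂ × ℂ), (∀ p ∈ S, p.1.re = p.2.re ∨ p.1.im = p.2.im) ∧ frontier Q'.carrier ⊆ ⋃ p ∈ S, segment ℝ p.1 p.2) → ∀ (ψ : ConformalEquiv UpperHalfPlane.upperHalfPlaneSet Q.carrier) (y : Fin 4 → ℝ) (ψ' : ConformalEquiv UpperHalfPlane.upperHalfPlaneSet Q'.carrier) (y' : Fin 4 → ℝ), Q.IsUniformizing ψ y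 → Q'.IsUniformizing ψ' y' → crossRatio y = crossRatio y' → Tendsto (fun δ : ℝ => bondDomainCrossingProb Q δ - bondDomainCrossingProb Q' δ) (𝓝[>] (0 : ℝ)) (𝓝 0))) :=
  fun hL => ⟨rectilinearInvariance_of_heartSansSim_of_limitExists hL,
    heartSansSim_of_rectilinearInvariance⟩

end Summit.CriticalPhenomena.CardyFormulaZ2.Cruxes.SimilarityUpgrade.Stubs

end
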